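import Summits.HodgeConjecture.HodgeConjecture.Theorems.K2LiuDoublingHeightDecayLocalR2OfNonsplitData   -- ★ (K2Liu-p04 g3): #32dR modulo the non-split place data
import Summits.HodgeConjecture.HodgeConjecture.Theorems.K2LiuNonsplitSliceIsotropic                    -- ★ (F4b, this seat): `exists_rankOneDatum_isotropic`
import Summits.HodgeConjecture.HodgeConjecture.Theorems.K2LiuNonsplitSliceAnisotropic                  -- ★ (AN) (K2Liu-p04 g3): `compactSpace_localPi_of_anisotropic`
import Summits.HodgeConjecture.HodgeConjecture.Theorems.K2E3RankOneTransvectionNormalForm             -- ★ (K2E3): `antidiagonal_two_over`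
import Literature.NumberTheory.Automorphic.LocalHermitianPlaneIsotropic                                -- ★ `exists_formCongr_eq_antidiag_two_of_hyperbolicPair`
import Literature.NumberTheory.Automorphic.AnisotropicUnitaryGroupCompactLocal                         -- ★ `exists_v_eq_exp_neg_one_adicCompletion`
import Literature.NumberTheory.Automorphic.QuadraticLocalBaseChange                                    -- ★ `PlacesOver.nonempty`
import HarnessLib

/-!
# Socket #32dR `sig_K2LiuDoublingHeightDecayLocalR2` BY VALUE — local convergence of the doubling height on `U(V)(L⁺_∞ × L⁺_S)` for `τ > 2·2 − 2`

Track B ∕ K2-LIT, hLiu418 = stmt-HodgeConjecture-24832; socket #32dR of `Cruxes/HLiu418/Lines/K2_Liu_CurveThetaSigs_U5d_ZetaS.lean` (ED. 5 :624), binders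
:626–:651 TOKEN FOR TOKEN.  LEAD F0P6-plan (g11) M-155f ∕ 04:36:28Z KEY (2) → K2Liu-p04 (g4): the BY-VALUE closer `doublingHeightDecayLocalR2`.
REPORT-FIRST `K2/K2Liu-p04/g4/REPORT-FIRST-26r-IsotropicAnyPlace.K2Liup04g4.md` (F5).

THE PROOF.  ★ `doublingHeightDecayLocalR2_of_nonsplitData` (K2Liu-p04 g3, p857289: archimedean part + split places of `S` discharged) leaves, at every NON-SPLIT `v ∈ S`
(all `w ∣ v` fixed by `c`), the alternative `IsCompact univ ∨ ‹rank-one Cartan decay datum›`.  Fix the place `w ∣ v` (★ `PlacesOver.nonempty`) and the place form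
`diag(dV)_w` of the curve datum over `L_w` with its pairing `h_w(x, y) = ᵗσ_w(x)·diag(dV)_w·y`:
* `h_w` ANISOTROPIC ⇒ `U(diag dV)(L⁺_v)` compact (★ (AN) `compactSpace_localPi_of_anisotropic`, K2Liu-p04 g3 over ★ `compactSpace_local_of_anisotropic`) ⇒ `U(H)(L⁺_v)`
  compact along the local congruence `κ_v` (★ D5 `localCongr`) ⇒ `Or.inl`;
* `h_w` ISOTROPIC (`h_w(x,x) = 0`, `x ≠ 0`) ⇒ `x₀ ≠ 0` and `y := (x₀, −x₁)∕(2·σ_w(x₀)·d₀·x₀)` is a hyperbolic partner (`h_w(y,y) = 0`, `h_w(x,y) = 1`; characteristic `0`)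
  ⇒ a RATIONAL hyperbolic frame `T₀` with `ᵗσ_w(T₀)·diag(dV)_w·T₀ = antidiag(1,1)` (★ `exists_formCongr_eq_antidiag_two_of_hyperbolicPair`) ⇒ `diag(dV)_w = ᵗσ_w(T₀⁻¹)·J₀·T₀⁻¹`
  ⇒ ★ (F4b) `exists_rankOneDatum_isotropic` (ANY ramification, ANY residue characteristic, a uniformiser from ★ `exists_v_eq_exp_neg_one_adicCompletion`) ⇒ `Or.inr`.
No unimodularity, no unramifiedness, no case split on the ramification of `v`: the inert, ramified, tame, wild and dyadic places of `S` are treated uniformly.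
Theorems only; no `def`, no `sorry`, default heartbeats.
[GelbartPiatetskishapiroRallis1987, Part A §6]; [Li1992, §3 Thm. 3.1]; [Liu2011, §2B Prop. 2.3 p. 862, §2C p. 863]; [Liu2021, Lem. B.10 (2) p. 102]; [PlatonovRapinchuk1994, §3.1, §3.3].
HONEST LABEL: HC_CM is proved only modulo the 7 printed citations (2 remaining named inputs: hLiu418 = stmt-HodgeConjecture-24832, h413 =
stmt-HodgeConjecture-24833) until rung 0 closes; this file pays socket #32dR by value and retires no counter by itself (K2Liu-plan re-ties the socket by import).
-/

set_option autoImplicit false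
-- the mandated namespace repeats the single-problem summit's segment (`HodgeConjecture.HodgeConjecture`)
set_option linter.dupNamespace false

noncomputable section

open scoped Matrix ComplexOrder
open MeasureTheory NumberField NumberField.InfinitePlace IsDedekindDomain Matrix

namespace Summit.HodgeConjecture.HodgeConjecture.Cruxes.HLiu418.K2LiuDoublingHeightDecayLocalR2

open Literature.NumberTheory.Automorphic Literature.NumberTheory.Automorphic.UnitaryGroup
open Literature.NumberTheory.GelbartRogawski1991 Literature.NumberTheory.GelbartRogawski1991.GRConstruction
open Literature.NumberTheory.K2Lit.SiegelDoubled Literature.NumberTheory.K2Lit.PlaceSplitting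
open Summit.HodgeConjecture.HodgeConjecture.Cruxes.HLiu418.K2LiuDoublingHeightDecayLocalR2OfNonsplitData
open Summit.HodgeConjecture.HodgeConjecture.Cruxes.HLiu418.K2LiuNonsplitSliceIsotropic
open Summit.HodgeConjecture.HodgeConjecture.Cruxes.HLiu418.K2LiuNonsplitSliceAnisotropic
open Summit.HodgeConjecture.HodgeConjecture.Cruxes.HLiu418.K2LiuDoublingSliceLocalBridge
open Summit.HodgeConjecture.HodgeConjecture.Cruxes.H413.K2E3RankOneTransvectionNormalForm (antidiagonal_two_over)

/-! ## §1 The dichotomy at a non-split place: anisotropic, or a rational hyperbolic frame -/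

/-- the pairing of a diagonal `2 × 2` form: `h(a, b) = σ(a₀)·d₀·b₀ + σ(a₁)·d₁·b₁`. [cite: Mok2014, §1 Notation p. 5] -/
theorem hermForm_diagonal_two {K : Type*} [CommRing K] (σ : K →+* K) (d a b : Fin 2 → K) :
    UnitaryGroup.hermForm σ (Matrix.diagonal d) a b = σ (a 0) * (d 0 * b 0) + σ (a 1) * (d 1 * b 1) := by
  rw [UnitaryGroup.hermForm_apply, dotProduct, Fin.sum_univ_two]
  simp [Matrix.mulVec_diagonal]

/-- **AN ISOTROPIC VECTOR OF A NON-DEGENERATE DIAGONAL HERMITIAN PLANE HAS A HYPERBOLIC PARTNER** (characteristic `≠ 2`, `σ` an involution):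
`h(x,x) = 0`, `x ≠ 0` ⇒ `h(y,y) = 0`, `h(x,y) = 1` for `y = (x₀, −x₁)∕(σ(x₀)d₀x₀ − σ(x₁)d₁x₁)`. [cite: Dieudonne1971GroupesClassiques, Chap. II §5] [cite: Jacobowitz1962, §3 Thm. 3.1] -/
theorem exists_hyperbolic_partner_diagonal_two {K : Type*} [Field K] [CharZero K] (σ : K →+* K) (hσ : ∀ s, σ (σ s) = s)
    {d : Fin 2 → K} (hd : ∀ i, d i ≠ 0) {x : Fin 2 → K} (hx0 : x ≠ 0)
    (hx : UnitaryGroup.hermForm σ (Matrix.diagonal d) x x = 0) :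
    ∃ y : Fin 2 → K, UnitaryGroup.hermForm σ (Matrix.diagonal d) y y = 0 ∧ UnitaryGroup.hermForm σ (Matrix.diagonal d) x y = 1 := by
  have hσ0 : ∀ {s : K}, s ≠ 0 → σ s ≠ 0 := fun {s} hs h => hs (by simpa [hσ] using congrArg σ h)
  rw [hermForm_diagonal_two] at hx
  -- `x₀ ≠ 0`
  have hx00 : x 0 ≠ 0 := by
    intro h0
    apply hx0
    have h1 : σ (x 1) * (d 1 * x 1) = 0 := by rw [h0, map_zero, zero_mul, zero_add] at hx; exact hx
    have hx1 : x 1 = 0 := by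
      by_contra h
      exact (mul_ne_zero (hσ0 h) (mul_ne_zero (hd 1) h)) h1
    funext i; fin_cases i
    · exact h0
    · exact hx1
  -- `κ₀ := σ(x₀)d₀x₀ − σ(x₁)d₁x₁ = 2σ(x₀)d₀x₀ ≠ 0`
  set κ₀ : K := σ (x 0) * (d 0 * x 0) - σ (x 1) * (d 1 * x 1) with hκ₀
  have hκ₀' : κ₀ = 2 * (σ (x 0) * (d 0 * x 0)) := by rw [hκ₀]; linear_combination -hx
  have hκ₀0 : κ₀ ≠ 0 := by
    rw [hκ₀']; exact mul_ne_zero two_ne_zero (mul_ne_zero (hσ0 hx00) (mul_ne_zero (hd 0) hx00))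
  refine ⟨fun i => κ₀⁻¹ * ![x 0, -(x 1)] i, ?_, ?_⟩
  · rw [hermForm_diagonal_two]
    simp only [Matrix.cons_val_zero, Matrix.cons_val_one, Matrix.cons_val_fin_one, map_mul, map_neg, mul_neg, neg_mul, neg_neg]
    have : σ κ₀⁻¹ * σ (x 0) * (d 0 * (κ₀⁻¹ * x 0)) + σ κ₀⁻¹ * σ (x 1) * (d 1 * (κ₀⁻¹ * x 1)) =
        σ κ₀⁻¹ * κ₀⁻¹ * (σ (x 0) * (d 0 * x 0) + σ (x 1) * (d 1 * x 1)) := by ring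
    rw [this, hx, mul_zero]
  · rw [hermForm_diagonal_two]
    simp only [Matrix.cons_val_zero, Matrix.cons_val_one, Matrix.cons_val_fin_one, mul_neg]
    have : σ (x 0) * (d 0 * (κ₀⁻¹ * x 0)) + -(σ (x 1) * (d 1 * (κ₀⁻¹ * x 1))) = κ₀⁻¹ * κ₀ := by rw [hκ₀]; ring
    rw [this, inv_mul_cancel₀ hκ₀0]

/-- the antidiagonal matrix of ★ `exists_formCongr_eq_antidiag_two_of_hyperbolicPair` is `J₀`. [folklore] -/
theorem of_antidiag_eq_antidiagonal_two {K : Type*} [Field K] :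
    (Matrix.of fun i j : Fin 2 => if i.val + j.val + 1 = 2 then (1 : K) else 0) = (StdForm.antidiagonal 2).over K := by
  rw [antidiagonal_two_over]
  ext i j
  fin_cases i <;> fin_cases j <;> rfl

/-- inverting a frame: `H = ᵗσ(T⁻¹) · (ᵗσ(T) H T) · T⁻¹`. [folklore] -/
theorem formCongr_inv_formCongr {K : Type*} [Field K] (σ : K →+* K) (T : GL (Fin 2) K) (H : Matrix (Fin 2) (Fin 2) K) :
    formCongr σ T⁻¹ (formCongr σ T H) = H := by
  change (((T⁻¹ : GL (Fin 2) K) : Matrix (Fin 2) (Fin 2) K).map σ)ᵀ * ((((T : GL (Fin 2) K) : Matrix (Fin 2) (Fin 2) K).map σ)ᵀ * H *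
    ((T : GL (Fin 2) K) : Matrix (Fin 2) (Fin 2) K)) * ((T⁻¹ : GL (Fin 2) K) : Matrix (Fin 2) (Fin 2) K) = H
  have h1 : (((T⁻¹ : GL (Fin 2) K) : Matrix (Fin 2) (Fin 2) K).map σ)ᵀ * ((((T : GL (Fin 2) K) : Matrix (Fin 2) (Fin 2) K).map σ)ᵀ) = 1 := by
    rw [← Matrix.transpose_mul, GLn.map_val_mul_map_val_inv σ T, Matrix.transpose_one]
  have h2 : ((T : GL (Fin 2) K) : Matrix (Fin 2) (Fin 2) K) * ((T⁻¹ : GL (Fin 2) K) : Matrix (Fin 2) (Fin 2) K) = 1 := by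
    rw [← Units.val_mul, mul_inv_cancel, Units.val_one]
  calc (((T⁻¹ : GL (Fin 2) K) : Matrix (Fin 2) (Fin 2) K).map σ)ᵀ * ((((T : GL (Fin 2) K) : Matrix (Fin 2) (Fin 2) K).map σ)ᵀ * H *
        ((T : GL (Fin 2) K) : Matrix (Fin 2) (Fin 2) K)) * ((T⁻¹ : GL (Fin 2) K) : Matrix (Fin 2) (Fin 2) K)
      = ((((T⁻¹ : GL (Fin 2) K) : Matrix (Fin 2) (Fin 2) K).map σ)ᵀ * ((((T : GL (Fin 2) K) : Matrix (Fin 2) (Fin 2) K).map σ)ᵀ)) * H *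
          (((T : GL (Fin 2) K) : Matrix (Fin 2) (Fin 2) K) * ((T⁻¹ : GL (Fin 2) K) : Matrix (Fin 2) (Fin 2) K)) := by
        simp only [Matrix.mul_assoc]
    _ = H := by rw [h1, h2, Matrix.one_mul, Matrix.mul_one]

/-! ## §2 The socket, by value -/

/-- **SOCKET #32dR BY VALUE: `∫_{G_∞ × G_S} Φ(ι(ιA placesEmbed x))^τ < ∞` for `τ > 2·2 − 2`.**  See the module docstring: ★ `_of_nonsplitData` + the
anisotropic ∕ isotropic dichotomy of `diag(dV)_w` at each non-split `v ∈ S` + ★ (AN) ∕ ★ (F4b).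
[cite: GelbartPiatetskishapiroRallis1987, Part A §6] [cite: Li1992, §3 Thm. 3.1] [cite: Liu2011, §2B Prop. 2.3 p. 862] [cite: Liu2021, Lem. B.10 (2) p. 102] -/
theorem doublingHeightDecayLocalR2 :
    ∀ (L : Type) [Field L] [NumberField L] [IsCMField L] {n : ℕ} (e : Fin 2 × Fin 1 ≃ Fin n)
      (dV : Fin 2 → L) (hdV : ∀ i, IsCMField.complexConj L (dV i) = dV i) (_hdV0 : ∀ i, dV i ≠ 0)
      (ι : L →+* ℂ) (_hpos : ∀ τ' : L →+* ℂ, InfinitePlace.mk τ' ≠ InfinitePlace.mk ι → ((Matrix.diagonal dV).map τ').PosDef)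
      (dW : Fin 1 → L) (hdW : ∀ i, IsCMField.complexConj L (dW i) = dW i) (_hdW0 : ∀ i, dW i ≠ 0)
      (H : Matrix (Fin 2) (Fin 2) L)
      (t : L) (_ht : t ≠ 0) (g : GL (Fin 2) L)
      (_hg : formCongr ((IsCMField.complexConj L : L ≃ₐ[↥(maximalRealSubfield L)] L) : L →+* L) g (t • H) = Matrix.diagonal dV)
      (ιA : (UnitaryGroup.adelicGroupData (Fp L) L (IsCMField.complexConj L) 2 H).Adelic →*
        UnitaryGroup.adelic (Fp L) L (IsCMField.complexConj L) 2 (Matrix.diagonal dV))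
      (_hιA : ∀ k, ((ιA k : ↥(UnitaryGroup.adelic (Fp L) L (IsCMField.complexConj L) 2 (Matrix.diagonal dV))) :
            GL (Fin 2) (AdeleRing (𝓞 L) L)) =
          (toAdeleGL L g)⁻¹ * UnitaryGroup.adelicVal (Fp L) L (IsCMField.complexConj L) 2 H k * toAdeleGL L g)
      (S : Finset (HeightOneSpectrum (𝓞 (Fp L)))) [DecidableEq (HeightOneSpectrum (𝓞 (Fp L)))]
      [MeasurableSpace (UnitaryGroup.arch (Fp L) L (IsCMField.complexConj L) 2 H)]
      [BorelSpace (UnitaryGroup.arch (Fp L) L (IsCMField.complexConj L) 2 H)]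
      [∀ v : HeightOneSpectrum (𝓞 (Fp L)), MeasurableSpace (UnitaryGroup.localPi L (IsCMField.complexConj L) 2 H v)]
      [∀ v : HeightOneSpectrum (𝓞 (Fp L)), BorelSpace (UnitaryGroup.localPi L (IsCMField.complexConj L) 2 H v)]
      (νinf : Measure (UnitaryGroup.arch (Fp L) L (IsCMField.complexConj L) 2 H)) [νinf.IsHaarMeasure]
      (νS : ∀ v : S, Measure (UnitaryGroup.localPi L (IsCMField.complexConj L) 2 H v.1)) [∀ v, (νS v).IsHaarMeasure]
      (Φ : HA L e dV hdV dW hdW → ℝ) (_hΦc : Continuous Φ) (_hΦpos : ∀ x, 0 < Φ x)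
      (_hΦ : ∀ p x : HA L e dV hdV dW hdW, IsSiegelDelta L e dV hdV dW hdW p →
        Φ (p * x) = modDelta L e dV hdV dW hdW p * Φ x)
      (τ : ℝ) (_hτ : 2 * (2 : ℝ) - 2 < τ),
      Integrable (fun x => Φ (iotaLeft L e dV hdV dW hdW (ιA (placesEmbed L H S x))) ^ τ) (νinf.prod (Measure.pi νS)) := by
  intro L _ _ _ n e dV hdV hdV0 ι hpos dW hdW hdW0 H t ht g hg ιA hιA S _ _ _ _ _ νinf _ νS _ Φ hΦc hΦpos hΦ τ hτ
  classical
  haveI : Algebra.IsQuadraticExtension (Fp L) L := IsCMField.isQuadraticExtension L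
  have hcc : IsCMField.complexConj L * IsCMField.complexConj L = 1 := AlgEquiv.ext fun x => IsCMField.complexConj_apply_apply L x
  refine doublingHeightDecayLocalR2_of_nonsplitData L e dV hdV hdV0 ι hpos dW hdW hdW0 H t ht g hg ιA hιA S νinf νS Φ hΦc hΦpos hΦ τ hτ
    fun v hns => ?_
  -- a place `w ∣ v` (fixed by `c`), the conjugation `σ_w`, the Borel structure on `U(diag dV)(L⁺_v)`
  obtain ⟨w⟩ := (inferInstance : Nonempty (UnitaryGroup.PlacesOver L v.1))
  have hw : IsCMField.complexConj L • w.1 = w.1 := hns w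
  set σ : w.1.adicCompletion L →+* w.1.adicCompletion L := galAdicCompletionMap (L := L) (IsCMField.complexConj L) hw with hσ
  have hσσ : ∀ s, σ (σ s) = s := Liu2021.galAdicCompletionMap_galAdicCompletionMap_self (Fp L) L (IsCMField.complexConj L) hcc hw
  letI : MeasurableSpace (UnitaryGroup.localPi L (IsCMField.complexConj L) 2 (Matrix.diagonal dV) v.1) := borel _
  haveI : BorelSpace (UnitaryGroup.localPi L (IsCMField.complexConj L) 2 (Matrix.diagonal dV) v.1) := ⟨rfl⟩
  haveI : CharZero (w.1.adicCompletion L) := charZero_of_injective_algebraMap (algebraMap L (w.1.adicCompletion L)).injective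
  -- the place form of the curve datum: `diag(dV)_w = diag(d)`, `σ`-hermitian with non-zero entries
  set d : Fin 2 → w.1.adicCompletion L := fun i => ((dV i : L) : w.1.adicCompletion L) with hd
  have hPF : UnitaryGroup.placeForm (Matrix.diagonal dV) w.1 = Matrix.diagonal d := by
    change (Matrix.diagonal dV).map (algebraMap L (w.1.adicCompletion L)) = Matrix.diagonal d
    rw [Matrix.diagonal_map (map_zero _)]
    rfl
  have hd0 : ∀ i, d i ≠ 0 := fun i h => hdV0 i ((map_eq_zero_iff _ (algebraMap L (w.1.adicCompletion L)).injective).1 h)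
  have hdσ : ∀ i, σ (d i) = d i := fun i => by
    rw [hd, hσ, galAdicCompletionMap_coe, AlgEquiv.smul_def, hdV]
  have hH : ((Matrix.diagonal d).map σ)ᵀ = Matrix.diagonal d := by
    rw [Matrix.diagonal_map (map_zero σ), Matrix.diagonal_transpose]
    exact congrArg Matrix.diagonal (funext hdσ)
  by_cases hanis : ∀ x : Fin 2 → w.1.adicCompletion L,
      UnitaryGroup.hermForm (galAdicCompletionMap (L := L) (IsCMField.complexConj L) hw) (UnitaryGroup.placeForm (Matrix.diagonal dV) w.1) x x = 0 → x = 0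
  · -- ANISOTROPIC: `U(diag dV)(L⁺_v)` is compact, hence so is `U(H)(L⁺_v)` along `κ_v`
    left
    haveI : CompactSpace (UnitaryGroup.localPi L (IsCMField.complexConj L) 2 (Matrix.diagonal dV) v.1) :=
      compactSpace_localPi_of_anisotropic L (Matrix.diagonal dV) v.1 w hw hanis
    haveI : CompactSpace (UnitaryGroup.localPi L (IsCMField.complexConj L) 2 H v.1) :=
      (localCongr L (IsCMField.complexConj L) g⁻¹ (inv_ne_zero ht) (formCongr_inv_inv_smul L H dV t ht g hg) v.1).symm.toHomeomorph.compactSpace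
    exact isCompact_univ
  · -- ISOTROPIC: a rational hyperbolic frame, then ★ (F4b)
    right
    push Not at hanis
    obtain ⟨x, hx, hx0⟩ := hanis
    rw [hPF] at hx
    obtain ⟨y, hy, hxy⟩ := exists_hyperbolic_partner_diagonal_two σ hσσ hd0 hx0 hx
    obtain ⟨T₀, hT₀⟩ := exists_formCongr_eq_antidiag_two_of_hyperbolicPair σ (Matrix.diagonal d) hσσ hH hx hy hxy
    rw [of_antidiag_eq_antidiagonal_two] at hT₀
    have hTJ : UnitaryGroup.placeForm (Matrix.diagonal dV) w.1 = formCongr σ T₀⁻¹ ((StdForm.antidiagonal 2).over (w.1.adicCompletion L)) := by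
      rw [hPF, ← hT₀, formCongr_inv_formCongr]
    obtain ⟨ϖ, hϖ⟩ := exists_v_eq_exp_neg_one_adicCompletion w.1
    exact exists_rankOneDatum_isotropic L e dV hdV dW hdW H t ht g hg ιA hιA S hdV0 hdW0 v (νS v) hΦc hΦpos hΦ w hw hϖ T₀⁻¹ hTJ hτ

end Summit.HodgeConjecture.HodgeConjecture.Cruxes.HLiu418.K2LiuDoublingHeightDecayLocalR2

end
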